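import Summits.ResolutionOfSingularities.ResolutionOfSingularities.Theorems.FrobeniusLadderFInjectiveMacaulayficationPencilExitWitness
import HarnessLib

/-!
# TASK 4b SOUNDNESS, the deep codes 5 / 6 of ✓p694236 («deep, k = p−1, i = 0»: `(M₂ + r)|_Z ≤ 1`, resp. `(M₂ + s)|_Z ≤ 1`): the `W`-chart is FULL at `(w₀; c)` — at `w₀ = 0`
# unconditionally, at `w₀ ≠ 0` whenever some letter `i ∈ Z` has `M₁ i ≠ 0 = r i` (true on all 181 code-5 pairs of ✓p694236) — and the `U`-chart is FULL at the pole `(0; c)`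
# (crux `FInjectiveMacaulayfication` stmt-ResolutionOfSingularities-15315, chain w45a; RULING R23.8 (3), plan-1 ACK l.85626; consumer res-L1-w45a-stub-3 TASK 4c; seat res-L1-w45a-stub-1 g15)

[OURS · L1 W4.5a] Support file (`--supports stmt-ResolutionOfSingularities-15315 --as helper`); theorems only; unconditional; any field, every prime `p`. Nothing of the crux is proved;
no census row is asserted. AI-written (AI review is weaker than expert review).

LETTER as in ✓p696297 (`W = X 0`, base letters `X i.succ`, closed point `(w₀; c)`, orbit `Z = {c = 0}`). The witness of code 5 is the `W⁰`-monomial `y^{(p−1)(M₂ + r)|_Z}` of the reduced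
Fedder element `(w₀A′ − B′)^{p−1}`, `A′ = α y^{M₁|_Z}`, `B′ = β y^{M₂|_Z}(ρ y^{r|_Z} − σ y^{s|_Z})`; inside `(−B′)^{p−1}` it is the pure `ρ`-power (unique because `r|_Z ≠ s|_Z`), and
the `w₀`-terms (multiples of `A′`) cannot reach it as soon as ONE letter `i ∈ Z` has `M₁ i ≠ 0 = r i` (its exponent there is `0 < M₁ i`; ✓ `PencilExitWitness.coeff_mul_pow_shift_eq`).
THE `w₀ ≠ 0` CAVEAT (for res-L1-w45a-stub-3ʼs list bridge): without that letter the code-5 monomial CAN be cancelled at isolated `w₀ ≠ 0` (e.g. `M₁|_Z = 2e₁`, `r|_Z = e₁`,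
`M₂|_Z = s|_Z = e₂`: `w₀αy₁² − βρy₁y₂ + βσy₂²` is a square at one `w₀`), the chart being FULL there by the code-8 monomial instead; the extra letter condition is p-free and holds on
every code-5 pair of the certified fans (session computation, stub-1 g15), so `exitOK`ʼs code 5 may simply be read with it.
* §1 `theta0_binomial` (the substitution on `y^{M₂}(u·y^r + v·y^s)`); §2 ★★ `fullCl_pencilChartW_deep` (core, `χ = u·y^r + v·y^s`, `u ≠ 0`), ★★ `fullCl_pencilChartW_code5`,
  ★★ `fullCl_pencilChartW_code6`; §3 ★★ `fullCl_pencilChartU_pole_deep`, `fullCl_pencilChartU_pole_code5`, `fullCl_pencilChartU_pole_code6` (pole, unconditional in `w₀`).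
[cite: Fedder1983, Thm. 1.12]
-/

set_option linter.dupNamespace false

noncomputable section

open AlgebraicGeometry IsLocalRing MvPolynomial
open scoped Pointwise

namespace Summit.ResolutionOfSingularities.ResolutionOfSingularities.Theorems.FInjectiveMacaulayfication.PencilExitTagDeep

open Summit.ResolutionOfSingularities.ResolutionOfSingularities.Theorems.FInjectiveMacaulayfication
open SliceableCentre PencilExitTagW PencilExitWitness

variable (k : Type) [Field k] {n : ℕ}

/-! ## §1 The substitution on the data -/

/-- The standard substitution `y_i ↦ y_i (c_i = 0), y_i ↦ c_i (c_i ≠ 0)` is of the shape the engine wants, with test letters `Z = {c = 0}`. [plumbing] -/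
theorem v0_shape [DecidableEq k] (c : Fin n → k) (i : Fin n) :
    (fun i : Fin n => if c i = 0 then (X i : MvPolynomial (Fin n) k) else C (c i)) i = C (c i) ∨
      (i ∈ {i : Fin n | c i = 0} ∧ (fun i : Fin n => if c i = 0 then (X i : MvPolynomial (Fin n) k) else C (c i)) i = X i + C (c i)) := by
  by_cases hci : c i = 0
  · right; refine ⟨hci, ?_⟩; dsimp only; rw [if_pos hci, hci, C_0, add_zero]
  · left; dsimp only; rw [if_neg hci]

/-- **The substitution on `y^{M₂}(u·y^r + v·y^s)`**: `= y^{M₂|_Z}·((βρu)·y^{r|_Z} + (βσv)·y^{s|_Z})` with `β, ρ, σ` the (non-zero) values of `y^{M₂}, y^r, y^s` off `Z`. [plumbing] -/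
theorem theta0_binomial [DecidableEq k] (c : Fin n → k) (M₂ r s : Fin n →₀ ℕ) (u v : k) :
    aeval (fun i : Fin n => if c i = 0 then (X i : MvPolynomial (Fin n) k) else C (c i)) (monomial M₂ (1 : k) * (C u * monomial r 1 + C v * monomial s 1)) =
      monomial (M₂.filter fun i => c i = 0) (1 : k) *
        (C ((∏ i ∈ M₂.support with c i ≠ 0, c i ^ M₂ i) * (∏ i ∈ r.support with c i ≠ 0, c i ^ r i) * u) * monomial (r.filter fun i => c i = 0) 1 +
          C ((∏ i ∈ M₂.support with c i ≠ 0, c i ^ M₂ i) * (∏ i ∈ s.support with c i ≠ 0, c i ^ s i) * v) * monomial (s.filter fun i => c i = 0) 1) := by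
  rw [map_mul, map_add, map_mul, map_mul, theta0_monomial, theta0_monomial, theta0_monomial, aeval_C, aeval_C, algebraMap_eq, map_mul, map_mul, map_mul, map_mul]
  ring

/-- Restriction to `Z` evaluates pointwise on `Z`. [plumbing] -/
theorem filter_apply_of_mem [DecidableEq k] (c : Fin n → k) (M : Fin n →₀ ℕ) (i : Fin n) (hci : c i = 0) : (M.filter fun i => c i = 0) i = M i :=
  Finsupp.filter_apply_pos (fun i => c i = 0) M hci

/-- `r|_Z ≠ s|_Z` from one letter of `Z` where they differ. [plumbing] -/
theorem filter_ne_filter [DecidableEq k] (c : Fin n → k) (r s : Fin n →₀ ℕ) (hne : ∃ i, c i = 0 ∧ r i ≠ s i) : (r.filter fun i => c i = 0) ≠ (s.filter fun i => c i = 0) := by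
  obtain ⟨i, hci, hrs⟩ := hne
  intro h
  have := DFunLike.congr_fun h i
  rw [filter_apply_of_mem k c r i hci, filter_apply_of_mem k c s i hci] at this
  exact hrs this

/-! ## §2 ★★ The `W`-chart -/

/-- ★★ **DEEP CORE, `W`-chart**: `Φ_W = (y^{M₁})⁺·W − (y^{M₂}(u·y^r + v·y^s))⁺` (`u ≠ 0`, `M₁ ⊥ M₂`) is FULL at the closed point `(w₀; c)` when `(M₂ + r)|_Z ≤ 1`, `r|_Z ≠ s|_Z`, and
either `w₀ = 0` or some `i ∈ Z` has `M₁ i ≠ 0 = r i`. Witness `W⁰·y^{(p−1)(M₂+r)|_Z}`. [OURS · TASK 4b soundness; cite: Fedder1983, Thm. 1.12] -/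
theorem fullCl_pencilChartW_deep (p : ℕ) [Fact p.Prime] [CharP k p] (M₁ M₂ r s : Fin n →₀ ℕ) (hdisj : ∀ i, M₁ i = 0 ∨ M₂ i = 0) (u v : k) (hu : u ≠ 0)
    (Φ : MvPolynomial (Fin (n + 1)) k)
    (hΦ : Φ = rename Fin.succ (monomial M₁ (1 : k)) * X 0 - rename Fin.succ (monomial M₂ (1 : k) * (C u * monomial r 1 + C v * monomial s 1))) (hΦp : Prime Φ)
    (c : Fin n → k) (w₀ : k) (y : Spec (.of (MvPolynomial (Fin (n + 1)) k ⧸ Ideal.span {Φ}))) (hy : y.asIdeal.IsMaximal)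
    (ha : y.asIdeal.comap (Ideal.Quotient.mk (Ideal.span {Φ})) =
      Ideal.span (Set.range (Fin.cons ((X 0 : MvPolynomial (Fin (n + 1)) k) - C w₀) fun i : Fin n => X i.succ - C (c i))))
    (htag : ∀ i, c i = 0 → M₂ i + r i ≤ 1) (hne : ∃ i, c i = 0 ∧ r i ≠ s i)
    (hw : w₀ = 0 ∨ ∃ i, c i = 0 ∧ M₁ i ≠ 0 ∧ r i = 0) :
    FullCl p ((Spec (.of (MvPolynomial (Fin (n + 1)) k ⧸ Ideal.span {Φ}))).presheaf.stalk y) := by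
  classical
  have hp1 : 1 ≤ p := (Fact.out : p.Prime).one_lt.le
  set v₀ : Fin n → MvPolynomial (Fin n) k := fun i => if c i = 0 then X i else C (c i) with hv₀
  -- the data after substitution
  set a := M₁.filter fun i => c i = 0 with ha'
  set b := M₂.filter fun i => c i = 0 with hb
  set r' := r.filter fun i => c i = 0 with hr'
  set s' := s.filter fun i => c i = 0 with hs'
  set α : k := ∏ i ∈ M₁.support with c i ≠ 0, c i ^ M₁ i with hα
  set β : k := ∏ i ∈ M₂.support with c i ≠ 0, c i ^ M₂ i with hβ
  set ρ : k := ∏ i ∈ r.support with c i ≠ 0, c i ^ r i with hρ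
  set σ : k := ∏ i ∈ s.support with c i ≠ 0, c i ^ s i with hσ
  have hβ0 : β ≠ 0 := theta0_scalar_ne_zero k c M₂
  have hρ0 : ρ ≠ 0 := theta0_scalar_ne_zero k c r
  have hA : aeval v₀ (monomial M₁ (1 : k)) = C α * monomial a 1 := by rw [hv₀, theta0_monomial]
  have hB : aeval v₀ (monomial M₂ (1 : k) * (C u * monomial r 1 + C v * monomial s 1)) = monomial b (1 : k) * (C (β * ρ * u) * monomial r' 1 + C (β * σ * v) * monomial s' 1) := by
    rw [hv₀, theta0_binomial]
  have hrs' : r' ≠ s' := filter_ne_filter k c r s hne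
  -- the target
  set N := p - 1 with hN
  set d₀ : Fin n →₀ ℕ := N • (b + r') with hd₀
  refine fullCl_linearChart_of_subst k p _ _ Φ hΦ hΦp c w₀ y hy ha v₀ {i | c i = 0} (v0_shape k c) 0 (Fact.out : p.Prime).pos d₀ (fun i hci => ?_) ?_
  · -- smallness on `Z`
    rw [Set.mem_setOf_eq] at hci
    rw [hd₀, Finsupp.smul_apply, Finsupp.add_apply, hb, hr', filter_apply_of_mem k c M₂ i hci, filter_apply_of_mem k c r i hci, smul_eq_mul]
    calc N * (M₂ i + r i) ≤ N * 1 := Nat.mul_le_mul_left _ (htag i hci)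
      _ < p := by omega
  · -- the coefficient
    rw [hA, hB, Nat.sub_zero, pow_zero, one_mul]
    have hshift : coeff d₀ ((C w₀ * (C α * monomial a 1) - monomial b (1 : k) * (C (β * ρ * u) * monomial r' 1 + C (β * σ * v) * monomial s' 1)) ^ N) =
        coeff d₀ ((-(monomial b (1 : k) * (C (β * ρ * u) * monomial r' 1 + C (β * σ * v) * monomial s' 1))) ^ N) := by
      rcases hw with hw0 | ⟨i, hci, hM₁i, hri⟩
      · rw [hw0, C_0, zero_mul, zero_sub]
      · have h := coeff_mul_pow_shift_eq k a (C α) (monomial b (1 : k) * (C (β * ρ * u) * monomial r' 1 + C (β * σ * v) * monomial s' 1)) w₀ 0 N d₀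
          ⟨i, by
            rw [hd₀, Finsupp.smul_apply, Finsupp.add_apply, hb, hr', ha', filter_apply_of_mem k c M₂ i hci, filter_apply_of_mem k c r i hci,
              filter_apply_of_mem k c M₁ i hci, (hdisj i).resolve_left hM₁i, hri, add_zero, smul_zero, zero_add, one_mul]
            exact Nat.pos_of_ne_zero hM₁i⟩
        rw [pow_zero, one_mul, one_mul, mul_comm (monomial a (1 : k)) (C α)] at h
        exact h
    rw [hshift]
    have h := coeff_deep_target k a b r' s' hrs' α (β * ρ * u) (β * σ * v) 0 N
    rw [pow_zero, one_mul, zero_smul, zero_add, ← hd₀, pow_zero, mul_one] at h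
    rw [h]
    exact mul_ne_zero (pow_ne_zero _ (neg_ne_zero.2 one_ne_zero)) (pow_ne_zero _ (mul_ne_zero (mul_ne_zero hβ0 hρ0) hu))

/-- ★★ **CODE 5** («deep, `k = p−1, i = 0`»): the `W`-chart `V(Φ_W)`, `Φ_W = (y^{M₁})⁺·W − (y^{M₂}(y^r − y^s))⁺`, is FULL at `(w₀; c)` when `(M₂ + r)|_Z ≤ 1` and `r|_Z ≠ s|_Z` (e.g. deep),
at `w₀ = 0` unconditionally and at `w₀ ≠ 0` when some `i ∈ Z` has `M₁ i ≠ 0 = r i`. (`M₁ ⊥ M₂`; every prime; `Φ_W` prime by ✓ `PencilPhiPrime.prime_pencilPhiW`.)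
[OURS · TASK 4b soundness; cite: Fedder1983, Thm. 1.12] -/
theorem fullCl_pencilChartW_code5 (p : ℕ) [Fact p.Prime] [CharP k p] (M₁ M₂ r s : Fin n →₀ ℕ) (hdisj : ∀ i, M₁ i = 0 ∨ M₂ i = 0)
    (Φ : MvPolynomial (Fin (n + 1)) k)
    (hΦ : Φ = rename Fin.succ (monomial M₁ (1 : k)) * X 0 - rename Fin.succ (monomial M₂ (1 : k) * (monomial r 1 - monomial s 1))) (hΦp : Prime Φ)
    (c : Fin n → k) (w₀ : k) (y : Spec (.of (MvPolynomial (Fin (n + 1)) k ⧸ Ideal.span {Φ}))) (hy : y.asIdeal.IsMaximal)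
    (ha : y.asIdeal.comap (Ideal.Quotient.mk (Ideal.span {Φ})) =
      Ideal.span (Set.range (Fin.cons ((X 0 : MvPolynomial (Fin (n + 1)) k) - C w₀) fun i : Fin n => X i.succ - C (c i))))
    (htag : ∀ i, c i = 0 → M₂ i + r i ≤ 1) (hne : ∃ i, c i = 0 ∧ r i ≠ s i)
    (hw : w₀ = 0 ∨ ∃ i, c i = 0 ∧ M₁ i ≠ 0 ∧ r i = 0) :
    FullCl p ((Spec (.of (MvPolynomial (Fin (n + 1)) k ⧸ Ideal.span {Φ}))).presheaf.stalk y) :=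
  fullCl_pencilChartW_deep k p M₁ M₂ r s hdisj 1 (-1) one_ne_zero Φ (by rw [hΦ, map_neg, C_1, one_mul, neg_one_mul, ← sub_eq_add_neg]) hΦp c w₀ y hy ha htag hne hw

/-- ★★ **CODE 6** («deep, `i = k = p−1`»): the same with `s` in place of `r`: FULL at `(w₀; c)` when `(M₂ + s)|_Z ≤ 1`, `r|_Z ≠ s|_Z`, and `w₀ = 0` or some `i ∈ Z` has `M₁ i ≠ 0 = s i`.
[OURS · TASK 4b soundness; cite: Fedder1983, Thm. 1.12] -/
theorem fullCl_pencilChartW_code6 (p : ℕ) [Fact p.Prime] [CharP k p] (M₁ M₂ r s : Fin n →₀ ℕ) (hdisj : ∀ i, M₁ i = 0 ∨ M₂ i = 0)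
    (Φ : MvPolynomial (Fin (n + 1)) k)
    (hΦ : Φ = rename Fin.succ (monomial M₁ (1 : k)) * X 0 - rename Fin.succ (monomial M₂ (1 : k) * (monomial r 1 - monomial s 1))) (hΦp : Prime Φ)
    (c : Fin n → k) (w₀ : k) (y : Spec (.of (MvPolynomial (Fin (n + 1)) k ⧸ Ideal.span {Φ}))) (hy : y.asIdeal.IsMaximal)
    (ha : y.asIdeal.comap (Ideal.Quotient.mk (Ideal.span {Φ})) =
      Ideal.span (Set.range (Fin.cons ((X 0 : MvPolynomial (Fin (n + 1)) k) - C w₀) fun i : Fin n => X i.succ - C (c i))))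
    (htag : ∀ i, c i = 0 → M₂ i + s i ≤ 1) (hne : ∃ i, c i = 0 ∧ r i ≠ s i)
    (hw : w₀ = 0 ∨ ∃ i, c i = 0 ∧ M₁ i ≠ 0 ∧ s i = 0) :
    FullCl p ((Spec (.of (MvPolynomial (Fin (n + 1)) k ⧸ Ideal.span {Φ}))).presheaf.stalk y) :=
  fullCl_pencilChartW_deep k p M₁ M₂ s r hdisj (-1) 1 (neg_ne_zero.2 one_ne_zero) Φ
    (by rw [hΦ, map_neg, C_1, one_mul, neg_one_mul, neg_add_eq_sub]) hΦp c w₀ y hy ha htag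
    (by obtain ⟨i, hci, h⟩ := hne; exact ⟨i, hci, Ne.symm h⟩) hw

/-! ## §3 ★★ The pole `U = 0` -/

/-- ★★ **DEEP CORE AT THE POLE**: the `U`-chart `V(Φ_U)`, `Φ_U = (y^{M₂}(u·y^r + v·y^s))⁺·U − (y^{M₁})⁺`, is FULL at the closed point `(0; c)` when `(M₂ + r)|_Z ≤ 1` and `r|_Z ≠ s|_Z`
(`u ≠ 0`; every prime; no condition on `M₁`). Witness `U^{p−1}·y^{(p−1)(M₂+r)|_Z}`. [OURS · TASK 4b soundness; cite: Fedder1983, Thm. 1.12] -/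
theorem fullCl_pencilChartU_pole_deep (p : ℕ) [Fact p.Prime] [CharP k p] (M₁ M₂ r s : Fin n →₀ ℕ) (u v : k) (hu : u ≠ 0)
    (Φ : MvPolynomial (Fin (n + 1)) k)
    (hΦ : Φ = rename Fin.succ (monomial M₂ (1 : k) * (C u * monomial r 1 + C v * monomial s 1)) * X 0 - rename Fin.succ (monomial M₁ (1 : k))) (hΦp : Prime Φ)
    (c : Fin n → k) (y : Spec (.of (MvPolynomial (Fin (n + 1)) k ⧸ Ideal.span {Φ}))) (hy : y.asIdeal.IsMaximal)
    (ha : y.asIdeal.comap (Ideal.Quotient.mk (Ideal.span {Φ})) =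
      Ideal.span (Set.range (Fin.cons (X 0 : MvPolynomial (Fin (n + 1)) k) fun i : Fin n => X i.succ - C (c i))))
    (htag : ∀ i, c i = 0 → M₂ i + r i ≤ 1) (hne : ∃ i, c i = 0 ∧ r i ≠ s i) :
    FullCl p ((Spec (.of (MvPolynomial (Fin (n + 1)) k ⧸ Ideal.span {Φ}))).presheaf.stalk y) := by
  classical
  have hp1 : 1 ≤ p := (Fact.out : p.Prime).one_lt.le
  set v₀ : Fin n → MvPolynomial (Fin n) k := fun i => if c i = 0 then X i else C (c i) with hv₀
  set b := M₂.filter fun i => c i = 0 with hb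
  set r' := r.filter fun i => c i = 0 with hr'
  set s' := s.filter fun i => c i = 0 with hs'
  set β : k := ∏ i ∈ M₂.support with c i ≠ 0, c i ^ M₂ i with hβ
  set ρ : k := ∏ i ∈ r.support with c i ≠ 0, c i ^ r i with hρ
  set σ : k := ∏ i ∈ s.support with c i ≠ 0, c i ^ s i with hσ
  have hβ0 : β ≠ 0 := theta0_scalar_ne_zero k c M₂
  have hρ0 : ρ ≠ 0 := theta0_scalar_ne_zero k c r
  have hB : aeval v₀ (monomial M₂ (1 : k) * (C u * monomial r 1 + C v * monomial s 1)) = monomial b (1 : k) * (C (β * ρ * u) * monomial r' 1 + C (β * σ * v) * monomial s' 1) := by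
    rw [hv₀, theta0_binomial]
  have hrs' : r' ≠ s' := filter_ne_filter k c r s hne
  set N := p - 1 with hN
  set d₀ : Fin n →₀ ℕ := N • (b + r') with hd₀
  refine fullCl_linearChart_pole_of_subst k p _ _ Φ hΦ hΦp c y hy ha v₀ {i | c i = 0} (v0_shape k c) N (by omega) d₀ (fun i hci => ?_) ?_
  · rw [Set.mem_setOf_eq] at hci
    rw [hd₀, Finsupp.smul_apply, Finsupp.add_apply, hb, hr', filter_apply_of_mem k c M₂ i hci, filter_apply_of_mem k c r i hci, smul_eq_mul]
    calc N * (M₂ i + r i) ≤ N * 1 := Nat.mul_le_mul_left _ (htag i hci)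
      _ < p := by omega
  · rw [hB, show p - 1 - N = 0 by omega, pow_zero, mul_one, mul_pow, monomial_pow, one_pow, hd₀, smul_add, coeff_monomial_mul', if_pos le_self_add, add_tsub_cancel_left,
      coeff_binomial_pow k r' s' hrs' _ _ N, one_mul]
    exact pow_ne_zero _ (mul_ne_zero (mul_ne_zero hβ0 hρ0) hu)

/-- ★★ **CODE 5 AT THE POLE**: `Φ_U = (y^{M₂}(y^r − y^s))⁺·U − (y^{M₁})⁺` is FULL at `(0; c)` when `(M₂ + r)|_Z ≤ 1` and `r|_Z ≠ s|_Z` (every prime; unconditional in the rest).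
[OURS · TASK 4b soundness; cite: Fedder1983, Thm. 1.12] -/
theorem fullCl_pencilChartU_pole_code5 (p : ℕ) [Fact p.Prime] [CharP k p] (M₁ M₂ r s : Fin n →₀ ℕ)
    (Φ : MvPolynomial (Fin (n + 1)) k)
    (hΦ : Φ = rename Fin.succ (monomial M₂ (1 : k) * (monomial r 1 - monomial s 1)) * X 0 - rename Fin.succ (monomial M₁ (1 : k))) (hΦp : Prime Φ)
    (c : Fin n → k) (y : Spec (.of (MvPolynomial (Fin (n + 1)) k ⧸ Ideal.span {Φ}))) (hy : y.asIdeal.IsMaximal)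
    (ha : y.asIdeal.comap (Ideal.Quotient.mk (Ideal.span {Φ})) =
      Ideal.span (Set.range (Fin.cons (X 0 : MvPolynomial (Fin (n + 1)) k) fun i : Fin n => X i.succ - C (c i))))
    (htag : ∀ i, c i = 0 → M₂ i + r i ≤ 1) (hne : ∃ i, c i = 0 ∧ r i ≠ s i) :
    FullCl p ((Spec (.of (MvPolynomial (Fin (n + 1)) k ⧸ Ideal.span {Φ}))).presheaf.stalk y) :=
  fullCl_pencilChartU_pole_deep k p M₁ M₂ r s 1 (-1) one_ne_zero Φ (by rw [hΦ, map_neg, C_1, one_mul, neg_one_mul, ← sub_eq_add_neg]) hΦp c y hy ha htag hne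

/-- ★★ **CODE 6 AT THE POLE**: the same with `s` in place of `r`. [OURS · TASK 4b soundness; cite: Fedder1983, Thm. 1.12] -/
theorem fullCl_pencilChartU_pole_code6 (p : ℕ) [Fact p.Prime] [CharP k p] (M₁ M₂ r s : Fin n →₀ ℕ)
    (Φ : MvPolynomial (Fin (n + 1)) k)
    (hΦ : Φ = rename Fin.succ (monomial M₂ (1 : k) * (monomial r 1 - monomial s 1)) * X 0 - rename Fin.succ (monomial M₁ (1 : k))) (hΦp : Prime Φ)
    (c : Fin n → k) (y : Spec (.of (MvPolynomial (Fin (n + 1)) k ⧸ Ideal.span {Φ}))) (hy : y.asIdeal.IsMaximal)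
    (ha : y.asIdeal.comap (Ideal.Quotient.mk (Ideal.span {Φ})) =
      Ideal.span (Set.range (Fin.cons (X 0 : MvPolynomial (Fin (n + 1)) k) fun i : Fin n => X i.succ - C (c i))))
    (htag : ∀ i, c i = 0 → M₂ i + s i ≤ 1) (hne : ∃ i, c i = 0 ∧ r i ≠ s i) :
    FullCl p ((Spec (.of (MvPolynomial (Fin (n + 1)) k ⧸ Ideal.span {Φ}))).presheaf.stalk y) :=
  fullCl_pencilChartU_pole_deep k p M₁ M₂ s r (-1) 1 (neg_ne_zero.2 one_ne_zero) Φ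
    (by rw [hΦ, map_neg, C_1, one_mul, neg_one_mul, neg_add_eq_sub]) hΦp c y hy ha htag
    (by obtain ⟨i, hci, h⟩ := hne; exact ⟨i, hci, Ne.symm h⟩)

end Summit.ResolutionOfSingularities.ResolutionOfSingularities.Theorems.FInjectiveMacaulayfication.PencilExitTagDeep

end
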